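import Summits.Schanuel.Schanuel.Theorems.ZilberEacDriftLeader
import Literature.ModelTheory.Zilber.EACDensityOscillatory
import HarnessLib

/-!
# THEOREM M, I: the triple expansion, the rotation lemma and the scalar asymptotics

Zilber's Exponential-Algebraic Closedness, case ladder (host summit Schanuel, cell `pub-schanuel`,
seat 2, gen 12).  THEOREMS J / J′ / K′ eliminate along lattice rays when the power coordinate
`w = y_{s+1}` has IRRATIONAL power growth, super-polynomial decay or super-polynomial growth;
THEOREM L needs a bounded power coordinate and THEOREM L″ a decaying one.  Over a REAL HYPERPLANE
base `x_{s+1} = Σ rᵢ xᵢ + c` in the slow regime the power coordinate along the labelled families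
`x_m = ρ_m + (log m) d + (2πi m) q` is

  `w_m = e^{c + r·ρ_m} · m^{λ} · e^{2πi m θ}`,   `λ = Σ rᵢ dᵢ`,   `θ = Σ rᵢ qᵢ`,

of POLYNOMIAL size `m^λ` with an arbitrary real (possibly rational) exponent and a ROTATING phase.
THEOREM M (`ZilberEacRotatingPower`) eliminates in this format as soon as `e^{2πiθ}` is not a root of
unity; this file supplies its three ingredients:

* `eval_cons_eq_triple_sum` — `H(w, ρ + τ d + y q) = Σ_{c,k,j} h_{c,k,j}(ρ) τ^j y^k w^c` (the
  `W`-expansion followed by the double line substitution of `ZilberEacDriftLeader`), with the degree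
  bounds `exists_triple_degree_bounds`;
* `not_tendsto_norm_eval_pow_of_rotation` — a nonzero polynomial cannot tend to `0` along a
  non-periodic rotation `ζ^m` (seat 1's `clusterIn_roots_of_tendsto` + `not_clusterIn_rotation`);
* `tendsto_exp_mul_mul_pow_div_pow`, `tendsto_pow_div_pow_of_lt` — the scalar comparisons
  `e^{aτ} τ^j / τ^{j*} → 0` (`a < 0`) and `τ^j/τ^{j*} → 0` (`j < j*`).

HONEST FRAMING: elimination lemmas; `EC(3,2)` OPEN; nothing here bears on Schanuel's conjecture
(EAC ⇏ SC).
-/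

noncomputable section

open MvPolynomial Filter Topology Finset Complex
open Literature.NumberTheory.Transcendental Literature.ModelTheory.Zilber

set_option linter.dupNamespace false

namespace Summit.Schanuel.Schanuel.Theorems

/-! ## Part A. The triple expansion -/

section Expansion

variable {t : ℕ}

/-- **Degree bounds for the triple expansion.**  For `P ∈ ℂ[X][W]` and directions `d, q` there are
`K, J` bounding the `Y`-degrees of all double substitutions of the `W`-coefficients and the
`T`-degrees of all their `Y`-coefficients. [folklore] -/
theorem exists_triple_degree_bounds (P : Polynomial (MvPolynomial (Fin t) ℂ)) (d q : Fin t → ℂ) :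
    ∃ K J : ℕ,
      (∀ c, (aeval (fun i => Polynomial.C (Polynomial.C (X i) + Polynomial.C (C (d i)) * Polynomial.X) +
          Polynomial.C (Polynomial.C (C (q i))) * Polynomial.X :
          Fin t → Polynomial (Polynomial (MvPolynomial (Fin t) ℂ))) (P.coeff c)).natDegree ≤ K) ∧
      ∀ c k, ((aeval (fun i => Polynomial.C (Polynomial.C (X i) + Polynomial.C (C (d i)) * Polynomial.X) +
          Polynomial.C (Polynomial.C (C (q i))) * Polynomial.X :
          Fin t → Polynomial (Polynomial (MvPolynomial (Fin t) ℂ))) (P.coeff c)).coeff k).natDegree ≤ J := by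
  classical
  generalize hψ : (fun i => Polynomial.C (Polynomial.C (X i) + Polynomial.C (C (d i)) * Polynomial.X) +
      Polynomial.C (Polynomial.C (C (q i))) * Polynomial.X :
      Fin t → Polynomial (Polynomial (MvPolynomial (Fin t) ℂ))) = ψ
  set K : ℕ := (range (P.natDegree + 1)).sup fun c => (aeval ψ (P.coeff c)).natDegree with hK
  have hKc : ∀ c, (aeval ψ (P.coeff c)).natDegree ≤ K := by
    intro c
    by_cases hc : c ≤ P.natDegree
    · exact Finset.le_sup (f := fun c => (aeval ψ (P.coeff c)).natDegree)
        (Finset.mem_range.2 (Nat.lt_succ_of_le hc))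
    · rw [Polynomial.coeff_eq_zero_of_natDegree_lt (lt_of_not_ge hc), map_zero,
        Polynomial.natDegree_zero]
      exact Nat.zero_le _
  set J : ℕ := (range (P.natDegree + 1)).sup fun c => (range (K + 1)).sup fun k =>
    ((aeval ψ (P.coeff c)).coeff k).natDegree with hJ
  refine ⟨K, J, hKc, fun c k => ?_⟩
  by_cases hc : c ≤ P.natDegree
  · by_cases hk : k ≤ K
    · have h1 : ((aeval ψ (P.coeff c)).coeff k).natDegree ≤
          (range (K + 1)).sup fun k => ((aeval ψ (P.coeff c)).coeff k).natDegree :=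
        Finset.le_sup (f := fun k => ((aeval ψ (P.coeff c)).coeff k).natDegree)
          (Finset.mem_range.2 (Nat.lt_succ_of_le hk))
      exact h1.trans (Finset.le_sup (f := fun c => (range (K + 1)).sup fun k =>
        ((aeval ψ (P.coeff c)).coeff k).natDegree) (Finset.mem_range.2 (Nat.lt_succ_of_le hc)))
    · rw [Polynomial.coeff_eq_zero_of_natDegree_lt ((hKc c).trans_lt (lt_of_not_ge hk)),
        Polynomial.natDegree_zero]
      exact Nat.zero_le _
  · rw [Polynomial.coeff_eq_zero_of_natDegree_lt (lt_of_not_ge hc), map_zero, Polynomial.coeff_zero,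
      Polynomial.natDegree_zero]
    exact Nat.zero_le _

/-- **The triple expansion.**  With `P = finSuccEquiv H` (the `W`-expansion, `W` = variable `0`) and
the double line substitution `X ↦ X + T d + Y q` applied to every `W`-coefficient:
`H(w, ρ + τ d + y q) = Σ_{c < D, k ≤ K, j ≤ J} h_{c,k,j}(ρ) τ^j y^k w^c`, where `h_{c,k,j}` is the
`T^j`-coefficient of the `Y^k`-coefficient of the substitution of the `W^c`-coefficient. [folklore] -/
theorem eval_cons_eq_triple_sum (H : MvPolynomial (Fin (t + 1)) ℂ) (d q ρ : Fin t → ℂ) (τ y w : ℂ)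
    {D K J : ℕ} (hD : (finSuccEquiv ℂ t H).natDegree < D)
    (hK : ∀ c, (aeval (fun i => Polynomial.C (Polynomial.C (X i) + Polynomial.C (C (d i)) * Polynomial.X) +
        Polynomial.C (Polynomial.C (C (q i))) * Polynomial.X :
        Fin t → Polynomial (Polynomial (MvPolynomial (Fin t) ℂ))) ((finSuccEquiv ℂ t H).coeff c)).natDegree ≤ K)
    (hJ : ∀ c k, ((aeval (fun i => Polynomial.C (Polynomial.C (X i) + Polynomial.C (C (d i)) * Polynomial.X) +
        Polynomial.C (Polynomial.C (C (q i))) * Polynomial.X :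
        Fin t → Polynomial (Polynomial (MvPolynomial (Fin t) ℂ)))
        ((finSuccEquiv ℂ t H).coeff c)).coeff k).natDegree ≤ J) :
    eval (Fin.cons w (ρ + τ • d + y • q) : Fin (t + 1) → ℂ) H =
      ∑ x ∈ range D ×ˢ (range (K + 1) ×ˢ range (J + 1)),
        eval ρ (((aeval (fun i => Polynomial.C (Polynomial.C (X i) + Polynomial.C (C (d i)) * Polynomial.X) +
            Polynomial.C (Polynomial.C (C (q i))) * Polynomial.X :
            Fin t → Polynomial (Polynomial (MvPolynomial (Fin t) ℂ)))
            ((finSuccEquiv ℂ t H).coeff x.1)).coeff x.2.1).coeff x.2.2) *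
          (τ ^ x.2.2 * y ^ x.2.1 * w ^ x.1) := by
  classical
  have hexpand : ∀ c, eval (ρ + τ • d + y • q) ((finSuccEquiv ℂ t H).coeff c) = _ :=
    fun c => eval_add_smul_add_smul ((finSuccEquiv ℂ t H).coeff c) d q ρ τ y
  generalize hψ : (fun i => Polynomial.C (Polynomial.C (X i) + Polynomial.C (C (d i)) * Polynomial.X) +
      Polynomial.C (Polynomial.C (C (q i))) * Polynomial.X :
      Fin t → Polynomial (Polynomial (MvPolynomial (Fin t) ℂ))) = ψ at hK hJ hexpand
  set P := finSuccEquiv ℂ t H with hP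
  set x := ρ + τ • d + y • q with hx
  have hdegD : (P.map (eval x)).natDegree < D := (Polynomial.natDegree_map_le).trans_lt hD
  rw [eval_eq_eval_mv_eval', ← hP, Polynomial.eval_eq_sum_range' hdegD, Finset.sum_product]
  simp only [Polynomial.coeff_map]
  refine Finset.sum_congr rfl fun c _ => ?_
  -- expand the `W^c`-coefficient along the double substitution
  set φ : Polynomial (MvPolynomial (Fin t) ℂ) →+* ℂ :=
    (Polynomial.evalRingHom τ).comp (Polynomial.mapRingHom (eval ρ)) with hφ
  have hφcoeff : ∀ k, φ ((aeval ψ (P.coeff c)).coeff k) =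
      ∑ j ∈ range (J + 1), eval ρ (((aeval ψ (P.coeff c)).coeff k).coeff j) * τ ^ j := by
    intro k
    rw [hφ, RingHom.comp_apply, Polynomial.coe_mapRingHom, Polynomial.coe_evalRingHom,
      Polynomial.eval_eq_sum_range' ((Polynomial.natDegree_map_le).trans_lt
        (Nat.lt_succ_of_le (hJ c k)))]
    simp only [Polynomial.coeff_map]
  have hdegK : ((aeval ψ (P.coeff c)).map φ).natDegree < K + 1 :=
    (Polynomial.natDegree_map_le).trans_lt (Nat.lt_succ_of_le (hK c))
  rw [hexpand c, Polynomial.eval_eq_sum_range' hdegK, Finset.sum_mul, Finset.sum_product]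
  refine Finset.sum_congr rfl fun k _ => ?_
  rw [Polynomial.coeff_map, hφcoeff, Finset.sum_mul, Finset.sum_mul]
  exact Finset.sum_congr rfl fun j _ => by ring

end Expansion

/-! ## Part B. The rotation lemma -/

section Rotation

/-- **No nonzero polynomial tends to zero along a non-periodic rotation.**  If `Q ≠ 0`, `|ζ| = 1`
and `ζ` is not a root of unity then `‖Q(ζ^m)‖ ↛ 0`. [folklore] -/
theorem not_tendsto_norm_eval_pow_of_rotation {Q : Polynomial ℂ} (hQ : Q ≠ 0) {ζ : ℂ}
    (hζ1 : ‖ζ‖ = 1) (hroot : ∀ j : ℕ, 0 < j → ζ ^ j ≠ 1) :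
    ¬ Tendsto (fun m : ℕ => ‖Q.eval (ζ ^ m)‖) atTop (𝓝 0) := fun h =>
  not_clusterIn_rotation (v := fun m : ℕ => ζ ^ m) one_ne_zero hζ1 hroot (fun _ => (one_mul _).symm) _
    (clusterIn_roots_of_tendsto hQ h)

end Rotation

/-! ## Part C. Scalar asymptotics -/

section Scalar

/-- `e^{aτ} τ^j / τ^{j*} → 0` along `τ → +∞` when `a < 0`. [folklore] -/
theorem tendsto_exp_mul_mul_pow_div_pow {τ : ℕ → ℝ} (hτ : Tendsto τ atTop atTop) {a : ℝ}
    (ha : a < 0) (j js : ℕ) :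
    Tendsto (fun m => Real.exp (a * τ m) * τ m ^ j / τ m ^ js) atTop (𝓝 0) := by
  -- `τ^j e^{aτ} → 0`
  have h1 : Tendsto (fun m => τ m ^ j * Real.exp (a * τ m)) atTop (𝓝 0) := by
    have h := (tendsto_rpow_mul_exp_neg_mul_atTop_nhds_zero (j : ℝ) (-a) (by linarith)).comp hτ
    refine h.congr' ?_
    filter_upwards [hτ.eventually_ge_atTop 0] with m hm
    simp only [Function.comp_apply, Real.rpow_natCast, neg_neg]
  have hτ1 : ∀ᶠ m in atTop, (1 : ℝ) ≤ τ m := hτ.eventually_ge_atTop 1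
  refine squeeze_zero_norm' ?_ h1
  filter_upwards [hτ1] with m hm
  have hτ0 : 0 < τ m := by linarith
  rw [Real.norm_eq_abs, abs_of_nonneg (by positivity), mul_comm (Real.exp _)]
  rw [div_le_iff₀ (pow_pos hτ0 _)]
  exact le_mul_of_one_le_right (by positivity) (one_le_pow₀ hm)

/-- `τ^j / τ^{j*} → 0` along `τ → +∞` when `j < j*`. [folklore] -/
theorem tendsto_pow_div_pow_of_lt {τ : ℕ → ℝ} (hτ : Tendsto τ atTop atTop) {j js : ℕ} (h : j < js) :
    Tendsto (fun m => τ m ^ j / τ m ^ js) atTop (𝓝 0) := by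
  have h1 : Tendsto (fun m => (τ m ^ (js - j))⁻¹) atTop (𝓝 0) :=
    ((tendsto_pow_atTop (Nat.sub_ne_zero_of_lt h)).comp hτ).inv_tendsto_atTop
  refine h1.congr' ?_
  filter_upwards [hτ.eventually_gt_atTop 0] with m hm
  have hne : τ m ≠ 0 := hm.ne'
  rw [eq_div_iff (pow_ne_zero _ hne), ← pow_sub_mul_pow (τ m) h.le, ← mul_assoc,
    inv_mul_cancel₀ (pow_ne_zero _ hne), one_mul]

end Scalar

end Summit.Schanuel.Schanuel.Theorems

end
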